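import Summits.QuantumFields.BalabanUV.Beta.D1BFx.WardJetsSourcesTorus

/-!
# `BalabanUV.Beta.D1BFx.TorusHodgeKernelGrad` — road «BF-x» for binder row D1, slot (K), identity side: **«WARD-L WITH SOURCES»** PART 3 —
# **`K̂·D̂ₛ = 0`: the torus `d*d` kills the FULL fine gradient** (`d*d ∘ d = 0` on ALL fine functions, not only on the block-mean-free slice of
# `TorusGaugeBasis.Khat_mul_What0`), hence PART 2's parity theorems WITHOUT their displayed kinematic hypothesis

HONEST DEPENDENCY (cell records, verbatim): «continuum YM on T⁴ ⇐ BetaPertH ∧ nine spine estimates (0/9 proved); BetaPertH ⇐ (D1) ∧ (D4) ∧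
CAP+tail; G-an2-4 gates asym, D1 and NE2/3/4.»  HONEST FRAMING (cell contract, verbatim): «discharging `BetaPertH` makes Bałaban's UV stability
UNCONDITIONAL — a real constructive-QFT result; it is NOT the continuum limit and NOT the Clay problem.»  THIS MODULE DISCHARGES NOTHING of (K),
of D1 or of the wall: [folklore] periodisation bookkeeping over an2's `AffineAveraging.curv_dz` (`d ∘ d = 0`), the road owner's
`TorusHodgeWeight.ccF` ∕ `ccF_apply` ∕ `Khat_eq_submatrix` ∕ `Dhat` ∕ `rowBound_dzKer`, this lineage's `TorusGaugeBasisKernel.tsum_mul_dzKer`,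
`TorusGaugeBasisMatrix.dzF`, an4's fibred product rule `FibredPeriodisation.periodiseF_compF`, and PART 2
(`WardJetsSourcesTorus`) BY NAME.  No `def`, no `def … : Prop`, nothing cited, 0 sorry.  0 binders discharged; (K) NOT closed; NOT D1, NOT
BetaPertH, NOT continuum, NOT Clay.

ABSOLUTE RULE (cell charter, verbatim): «No internally-minted statement may enter as a cited fact. Every hypothesis is either kernel-proved in this
package or a verbatim quotation of a PUBLISHED theorem with page reference. The manuscript(s) under audit are NOT citable for their own disputed
steps — they are the thing under adjudication; programme-internal (2001/route/tribunal) claims are never citable.»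

WHY (my INTENT journal l.32638; Q-WL-2).  PART 2's `hadamard_of_tip_antisymm_torus` ∕ `symPart_midpoint_torus_eq_zero` display `Khat * DhatS = 0`.
On `ℤ⁴`: `Σ_l Σ'_y (d*d δ_{(l,y)})_κ(x)·dzKer l y z = (d*d (d δ_z))_κ(x) = 0` (the two-point column sum `tsum_mul_dzKer`, linearity of `A ↦ (curvAdj (curv A))_κ(x)`,
`curv_dz`); periodised (`periodiseF_compF_matrix` with the absolutely summable rows of `ccF` from `spr_bhK` and the periodic, row-bounded `dzKer`) this is
`(ccF)^·D̂ = 0` on every fine torus (`periodiseF_compF`, entrywise), and with the sum re-indexed along `e₁` it is `K̂·D̂ₛ = 0`.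
CONTENT (all [folklore]): §1 `curvAdj_curv_add_apply`, `sum_delta1_shift_sub_eq_dz`, **`sum_tsum_ccF_mul_dzKer`** (`= 0`), `compF_ccF_dzF`; §2
`periodiseF_ccF_mul_Dhat` (`(ccF (m+1))^ · Dhat 4 ((m+1)p) = 0`), **`Khat_mul_DhatS`** (`Khat (m+1) p * DhatS m p = 0`); §3 PART 2's parity theorems
hypothesis-free: **`hadamard_of_tip_antisymm_torus'`**, **`symPart_midpoint_torus_eq_zero'`**.
NOT HERE (honest): any decision on Q-WL-2 (an2), the value of the Hadamard word on the road's tori (toy T-d1leaf03g14-HADAMARD: non-zero at every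
bond for block sides 2, 3 — a computation, not a theorem), «(A1) v2».
Unit `b2b-balaban-beta-d1-formalise-leaf-03` (gen 14), D1 formalisation swarm LEAF PROVER 03; road owner `b2b-balaban-beta-d1-p2`.
-/

noncomputable section

namespace Summit.QuantumFields.BalabanUV.Beta.D1BFx.TorusHodgeKernelGrad

open Matrix
open scoped BigOperators
open Literature.MathematicalPhysics.QuantumFieldTheory.Balaban1983to89
open Literature.MathematicalPhysics.QuantumFieldTheory.Balaban1983to89.Beta
open AffineAveraging (Form0 Form1 unitVec dz curv curvAdj box toSite curv_dz)
open KKTFluctuationKernel (delta1 delta1_apply)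
open KernelSpecInstance (curv_add curvAdj_add)
open B6QGQLower276 (X)
open Summit.QuantumFields.BalabanUV.Beta.TameKernelCalculus (Spr)
open Summit.QuantumFields.BalabanUV.Beta.BorderedHessian (bhK spr_bhK)
open Summit.QuantumFields.BalabanUV.Beta.D1BFx.FibredPeriodisation (FKer Kfib Kfib_apply compF periodiseF periodiseF_compF)
open Summit.QuantumFields.BalabanUV.Beta.D1BFx.PeriodicArrays (toF toF_apply)
open Summit.QuantumFields.BalabanUV.Beta.D1BFx.SortedKernels (periodiseF_zero_apply)
open Summit.QuantumFields.BalabanUV.Beta.D1BFx.SortedReblocking (summable_abs_row)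
open Summit.QuantumFields.BalabanUV.Beta.D1BFx.PackedKernelSplit (blk decays_blk)
open Summit.QuantumFields.BalabanUV.Beta.D1BFx.SortedEmbedding (e₁)
open Summit.QuantumFields.BalabanUV.Beta.D1BFx.StencilKernels (dzKer isPeriodic₂_dzKer)
open Summit.QuantumFields.BalabanUV.Beta.D1BFx.TorusCombKKT (I CombRows Khat)
open Summit.QuantumFields.BalabanUV.Beta.D1BFx.TorusGaugeBasis (What0)
open Summit.QuantumFields.BalabanUV.Beta.D1BFx.TorusGaugeBasisMatrix (Nhat dzF)
open Summit.QuantumFields.BalabanUV.Beta.D1BFx.TorusGaugeBasisKernel (tsum_mul_dzKer)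
open Summit.QuantumFields.BalabanUV.Beta.D1BFx.TorusHodgeWeight (ccF ccF_apply Dhat DhatS Khat_eq_submatrix rowBound_dzKer)
open Summit.QuantumFields.BalabanUV.Beta.D1BFx.TorusCoframeJets (tip)
open Summit.QuantumFields.BalabanUV.Beta.D1BFx.WardJetsSourcesTorus (hadamard_of_tip_antisymm_torus symPart_midpoint_torus_eq_zero)

/-! ## §1 On `ℤ⁴`: `d*d ∘ d = 0` read on the `d*d` entry kernel -/

/-- [folklore] The linear functional `A ↦ (curvAdj (curv A))_κ(x)` is additive (an2's `KernelSpecInstance.curv_add` ∕ `curvAdj_add`, read at an entry). -/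
theorem curvAdj_curv_add_apply (A B : Form1 4 ℝ) (κ : Fin 4) (x : X 4) :
    curvAdj (curv (A + B)) κ x = curvAdj (curv A) κ x + curvAdj (curv B) κ x := by
  rw [curv_add, curvAdj_add, Pi.add_apply, Pi.add_apply]

/-- [folklore] `Σ_l (δ_{(l, z − e_l)} − δ_{(l, z)}) = d δ_z`: the 1-form with entries `[y = z − e_l] − [y = z]` is the gradient of the site indicator of `z`. -/
theorem sum_delta1_shift_sub_eq_dz (z : X 4) :
    ∑ l : Fin 4, (delta1 l (z - unitVec l) - delta1 l z) = dz (fun y : X 4 => if y = z then (1 : ℝ) else 0) := by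
  funext l y
  rw [Finset.sum_apply, Finset.sum_apply]
  simp only [Pi.sub_apply, delta1_apply, dz]
  rw [Finset.sum_eq_single l]
  · simp only [true_and]
    have h : (y = z - unitVec l) ↔ (y + unitVec l = z) := eq_sub_iff_add_eq
    by_cases hy : y = z - unitVec l
    · rw [if_pos hy, if_pos (h.1 hy)]
    · rw [if_neg hy, if_neg (fun e => hy (h.2 e))]
  · intro l' _ hl'
    rw [if_neg (fun e => hl' e.1.symm), if_neg (fun e => hl' e.1.symm), sub_zero]
  · intro h; exact absurd (Finset.mem_univ l) h

/-- [folklore] **`d*d ∘ d = 0` ON THE ENTRY KERNEL**: `Σ_l Σ'_y ccF n (x,κ) (y,l)·dzKer l y z = 0` for all `x κ z` (`ccF_apply`: the entry is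
`(curvAdj (curv δ_{(l,y)}))_κ(x)`; the two-point column sum `tsum_mul_dzKer`; linearity; `sum_delta1_shift_sub_eq_dz`; `curv_dz`). -/
theorem sum_tsum_ccF_mul_dzKer (n : ℕ) (x z : X 4) (κ : Fin 4) : ∑ l : Fin 4, ∑' y : X 4, ccF n (x, κ) (y, l) * dzKer l y z = 0 := by
  -- the additive functional `A ↦ (curvAdj (curv A))_κ(x)`
  let Φ : Form1 4 ℝ →+ ℝ :=
    { toFun := fun A => curvAdj (curv A) κ x
      map_zero' := by simp [curvAdj, curv]
      map_add' := fun A B => curvAdj_curv_add_apply A B κ x }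
  have hΦ : ∀ A : Form1 4 ℝ, Φ A = curvAdj (curv A) κ x := fun _ => rfl
  have h1 : ∀ l : Fin 4, ∑' y : X 4, ccF n (x, κ) (y, l) * dzKer l y z = Φ (delta1 l (z - unitVec l)) - Φ (delta1 l z) := by
    intro l
    simp_rw [ccF_apply]
    rw [tsum_mul_dzKer l z (fun y => curvAdj (curv (delta1 l y)) κ x), hΦ, hΦ]
  simp_rw [h1, ← map_sub]
  rw [← map_sum, sum_delta1_shift_sub_eq_dz, hΦ, curv_dz]
  simp [curvAdj]

/-- [folklore] Kernel form: the fibred composition of the `d*d` entry kernel with the gradient kernel VANISHES, `compF (ccF n) dzF = 0`. -/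
theorem compF_ccF_dzF (n : ℕ) : compF (ccF n) (dzF (d := 3)) = fun _ _ => (0 : ℝ) := by
  funext i j
  obtain ⟨x, κ⟩ := i
  obtain ⟨z, u⟩ := j
  rw [compF]
  exact sum_tsum_ccF_mul_dzKer n x z κ

/-! ## §2 On the fine torus: `(ccF)^·D̂ = 0`, hence `K̂·D̂ₛ = 0` -/

variable (m : ℕ) (p : ℕ) [NeZero p]

/-- [folklore] Absolutely summable rows of the `d*d` entry kernel (a finite stencil; via `spr_bhK` ∕ `decays_blk` ∕ `summable_abs_row`). -/
theorem summable_abs_Kfib_ccF (κ l : Fin 4) (x : X 4) : Summable fun y : X 4 => |Kfib (ccF (m + 1)) κ l x y| := by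
  obtain ⟨C, δ, hδ, h⟩ := spr_bhK (d := 3) (N := m + 1) (Nat.succ_le_succ (Nat.zero_le m))
  have hs := summable_abs_row (decays_blk h true true) hδ x κ l
  refine hs.congr fun y => ?_
  rfl

/-- [folklore] **`(ccF (m+1))^ · D̂ = 0` ON THE FINE TORUS** of period `(m+1)·p` (entrywise: the fibred product rule `periodiseF_compF` + `compF_ccF_dzF`;
`D̂ (y,l) z = periodise₂ (dzKer l) y z = (dzF)^ (y,l) (z,())` by `rfl`). -/
theorem periodiseF_ccF_mul_Dhat :
    Matrix.of (periodiseF ((m + 1) * p) (ccF (m + 1))) * Dhat 4 ((m + 1) * p) = 0 := by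
  ext i z
  rw [Matrix.mul_apply, Matrix.zero_apply]
  have h := periodiseF_compF (s := (m + 1) * p) (summable_abs_Kfib_ccF m) (fun b _ => isPeriodic₂_dzKer (d := 3 + 1) b _)
    (fun b _ => rowBound_dzKer (d := 3 + 1) b) (K := ccF (m + 1)) (L := dzF (d := 3)) i (z, PUnit.unit)
  rw [compF_ccF_dzF, periodiseF_zero_apply] at h
  rw [h]
  exact Finset.sum_congr rfl fun j _ => rfl

/-- [folklore] **`K̂ · D̂ₛ = 0`**: the torus `d*d` (`TorusCombKKT.Khat`, sorted currency) kills the FULL sorted fine gradient `TorusHodgeWeight.DhatS` —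
the kinematic input displayed by PART 2 §3 (`Khat_eq_submatrix` + `periodiseF_ccF_mul_Dhat`, the sum re-indexed along `e₁`). -/
theorem Khat_mul_DhatS : Khat (d := 3) (m + 1) p * DhatS m p = 0 := by
  ext i z
  rw [Matrix.mul_apply, Matrix.zero_apply, Khat_eq_submatrix, DhatS]
  simp only [Matrix.submatrix_apply, id]
  have h := congrFun (congrFun (periodiseF_ccF_mul_Dhat m p) (e₁ (m + 1) p i)) z
  rw [Matrix.mul_apply, Matrix.zero_apply] at h
  rw [← h]
  exact Fintype.sum_equiv (e₁ (m + 1) p) _ _ fun j => rfl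

/-! ## §3 PART 2's parity theorems, hypothesis-free -/

variable {m} {r : Fin (3 + 1) → ℕ}

/-- [folklore] **Q-WL-2 ON THE ROAD's TORI (tip read-out), UNCONDITIONAL FORM**: an ANTISYMMETRIC table `kb` satisfying the order-one Ward letter WITH
SOURCE at the torus bond `b` forces `Σ_j K̂[j, e₁⁻¹ b]·Ŵ₀[j,a]·Ŵ₀[j,a′] = 0` for all comb bonds `a a′` (PART 2 `hadamard_of_tip_antisymm_torus` with
`Khat_mul_DhatS` supplied).  The toy T-d1leaf03g14-HADAMARD finds this word NON-ZERO at every bond for block sides 2 and 3 — so there no antisymmetric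
`kb` satisfies the tip letter (a computation, recorded in the journal; not a theorem here). -/
theorem hadamard_of_tip_antisymm_torus' (hr : r ∈ box (3 + 1) (m + 1)) (b : Site 4 ((m + 1) * p) × Fin 4)
    (kb : Matrix (I 3 (m + 1) p) (I 3 (m + 1) p) ℝ) (hkb : kbᵀ = -kb) (Wb : Matrix (I 3 (m + 1) p) (CombRows (toSite r) (m + 1) p) ℝ)
    (h : kb * What0 r (m + 1) p + Khat (d := 3) (m + 1) p * Wb
      = -Matrix.of (fun j a => Khat (d := 3) (m + 1) p j ((e₁ (m + 1) p).symm b) * Nhat r (m + 1) p (tip ((m + 1) * p) (e₁ (m + 1) p j)) a))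
    (a a' : CombRows (toSite r) (m + 1) p) :
    ∑ j, Khat (d := 3) (m + 1) p j ((e₁ (m + 1) p).symm b) * (What0 r (m + 1) p j a * What0 r (m + 1) p j a') = 0 :=
  hadamard_of_tip_antisymm_torus p hr (Khat_mul_DhatS m p) b kb hkb Wb h a a'

/-- [folklore] **THE MIDPOINT READ-OUT CARRIES NO PARITY CONSTRAINT, UNCONDITIONAL FORM** (PART 2 `symPart_midpoint_torus_eq_zero` with `Khat_mul_DhatS`). -/
theorem symPart_midpoint_torus_eq_zero' (hr : r ∈ box (3 + 1) (m + 1)) (Nt : I 3 (m + 1) p → CombRows (toSite r) (m + 1) p → ℝ)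
    (hNt : ∀ j a, Nt j a = (Nhat r (m + 1) p (tip ((m + 1) * p) (e₁ (m + 1) p j)) a + Nhat r (m + 1) p (e₁ (m + 1) p j).1 a) / 2)
    (i : I 3 (m + 1) p) :
    (What0 r (m + 1) p)ᵀ * Matrix.of (fun j a => Khat (d := 3) (m + 1) p j i * Nt j a)
      + ((What0 r (m + 1) p)ᵀ * Matrix.of (fun j a => Khat (d := 3) (m + 1) p j i * Nt j a))ᵀ = 0 :=
  symPart_midpoint_torus_eq_zero p hr (Khat_mul_DhatS m p) Nt hNt i

end Summit.QuantumFields.BalabanUV.Beta.D1BFx.TorusHodgeKernelGrad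

end
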